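import Literature.Computability.Complexity.OneInThreeSAT
import Literature.Computability.Complexity.KarpProblems
import HarnessLib

/-!
# ONE-IN-THREE 3SAT to 3-DIMENSIONAL MATCHING: a garbage-free ring gadget (combinatorial half)

Support file for the discharge of `Literature.Computability.Complexity.isNPComplete_THREEDM`
(`KarpProblems.lean`; Karp 1972, Main Theorem, problem 17; Garey–Johnson 1979, Thm. 3.2). The tree
proves ONE-IN-THREE 3SAT NP-hard (`Schaefer1978_oneInThreeSAT_NPHard_holds`,
`OneInThreeSATMachine.lean`), so 3DM is reached by ONE Karp reduction `ONEIN3SAT ≤ₚ THREEDM`. This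
file is its combinatorial half: an instance `ThreeDM.inst φ = ⟨q, U⟩` of `threeDMSet` for every clause
list `φ`, and the theorem

* `ThreeDM.xSatisfiable_iff_mem_threeDMSet`: if every clause of `φ` has three literals, then `φ` is
  one-in-three satisfiable iff `⟨q, U⟩` has a perfect 3-dimensional matching.

## The construction (Garey–Johnson's truth-setting ring, re-indexed by occurrences; no garbage)

Garey–Johnson (proof of Thm. 3.2, from 3SAT) use per variable `u_i` a ring of `2m` triples
`T_i^t = {(ū_i[j], a_i[j], b_i[j])}`, `T_i^f = {(u_i[j], a_i[j+1], b_i[j])}` through internal elements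
`a_i[j], b_i[j]` ("any matching will have to include … either all triples in `T_i^t` or all triples in
`T_i^f`"), one satisfaction-testing pair `s_1[j], s_2[j]` per clause, and a garbage collection
component absorbing the `m(n-1)` tips left over. Here the source problem is ONE-IN-THREE 3SAT, and
the printed ring is kept but indexed by OCCURRENCES `o = 3j + p < M = 3m` (literal `p` of clause `j`)
instead of (variable, clause) pairs: the ring of a variable links each occurrence `o` to the cyclically
next occurrence `next o` of the same variable; occurrence `o` has the two tips `tip o false = 2o`
(the printed `u[j]`) and `tip o true = 2o + 1` (`ū[j]`); the ring triples are
`t_o = (o, o, 2o+1)` and `f_o = (next o, o, 2o)`. A perfect matching takes, for each variable, all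
its `t_o` (variable TRUE: the tips `2o` stay free) or all its `f_o`. Exactly-one semantics makes
garbage collection unnecessary: clause `j` gets THREE selectors `e = M + 3j + s`, `s ∈ {0,1,2}`, with
triples `(e, e, tipFor s o)` for its three occurrences `o`, where selector `0` wants the tip that is
free iff the literal of `o` is TRUE and selectors `1, 2` want the tip that is free iff it is FALSE.
So all `2M` first coordinates, `2M` second coordinates and `2M` tips are covered exactly when every
clause has exactly one true and two false literals (`q = 2M = 6m`, `|U| = 15m`).

## Main statements

* `ThreeDM.P φ a b c` (the triple set as a decidable predicate), `ThreeDM.U`, `ThreeDM.inst`;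
  `ThreeDM.next` (via `Nat.find` on cyclic offsets) with `isNext_iff` (its bounded, search-free
  characterisation `ThreeDM.IsNext`, the form a polynomial-time machine tests), `next_injective`,
  `exists_iterate_next_eq` (the ring of a variable passes through all its occurrences);
* `mem_threeDMSet_of_xSatisfiable` (completeness: the explicit matching `cA`, `cC`),
  `xSatisfiable_of_mem_threeDMSet` (soundness: ring consistency `ring_step`, selectors read off the
  literal values), `xSatisfiable_iff_mem_threeDMSet`;
* `ThreeDM.PM` / `PM_iff_P` and `encode_inst` (the code of `⟨q, U⟩` under `encodingTriples`: the
  numeral of `q` paired with the bit vector `k ↦ [P (k / q²) ((k mod q²) / q) (k mod q)]`), the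
  interface of the machine half.

## References

* [GareyJohnson1979] M. R. Garey, D. S. Johnson, *Computers and Intractability*, Freeman 1979,
  §3.1.2, Thm. 3.2 (3DM is NP-complete; truth-setting and fan-out rings, satisfaction testing,
  garbage collection), book pp. 50–53 (held: book:garey1979-…, PDF pp. 54–56).
* [Karp1972] R. M. Karp, *Reducibility among combinatorial problems*, in: Complexity of Computer
  Computations, Plenum 1972, §3–§4, Main Theorem, problem 17 (3-DIMENSIONAL MATCHING).
* [Schaefer1978] T. J. Schaefer, *The complexity of satisfiability problems*, STOC 1978
  (ONE-IN-THREE 3SAT; Garey–Johnson [LO4]).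
-/

namespace Literature.Computability.Complexity

namespace ThreeDM

open _root_.Computability

/-! ### Occurrences of a clause list -/

/-- The number `M = 3m` of literal occurrences of a list of `m` three-literal clauses. [folklore] -/
def M (φ : CNF ℕ) : ℕ := 3 * φ.length

/-- The size `q = 2M = 6m` of each coordinate class of the instance. [folklore] -/
def q (φ : CNF ℕ) : ℕ := 2 * M φ

/-- Unfolding of `M`. [folklore] -/
theorem M_eq (φ : CNF ℕ) : M φ = 3 * φ.length := rfl

/-- Unfolding of `q`. [folklore] -/
theorem q_eq (φ : CNF ℕ) : q φ = 2 * M φ := rfl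

/-- The literal of occurrence `o = 3j + p`: literal `p` of clause `j` (junk `(0, false)` out of range).
[folklore] -/
def lit (φ : CNF ℕ) (o : ℕ) : Literal ℕ := (φ.getD (o / 3) []).getD (o % 3) (0, false)

/-- The variable of occurrence `o`. [folklore] -/
def var (φ : CNF ℕ) (o : ℕ) : ℕ := (lit φ o).1

/-- The polarity of occurrence `o` (`true` = positive literal). [folklore] -/
def pol (φ : CNF ℕ) (o : ℕ) : Bool := (lit φ o).2

variable {φ : CNF ℕ}

/-- In a list of three-literal clauses, occurrence `3j + p` is literal `p` of clause `j`. [folklore] -/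
theorem lit_eq_getElem (h3 : ∀ c ∈ φ, c.length = 3) {j : ℕ} (hj : j < φ.length) {p : ℕ} (hp : p < 3) :
    lit φ (3 * j + p) = (φ[j])[p]'(by rw [h3 _ (List.getElem_mem hj)]; exact hp) := by
  have h1 : (3 * j + p) / 3 = j := by omega
  have h2 : (3 * j + p) % 3 = p := by omega
  rw [lit, h1, h2, List.getD_eq_getElem _ _ hj, List.getD_eq_getElem]

/-- A three-literal clause is the list of its three occurrences. [folklore] -/
theorem getElem_eq_lits (h3 : ∀ c ∈ φ, c.length = 3) {j : ℕ} (hj : j < φ.length) :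
    φ[j] = [lit φ (3 * j), lit φ (3 * j + 1), lit φ (3 * j + 2)] := by
  have hl : (φ[j]).length = 3 := h3 _ (List.getElem_mem hj)
  obtain ⟨a, b, c, habc⟩ := List.length_eq_three.1 hl
  have e0 := lit_eq_getElem h3 hj (p := 0) (by norm_num)
  have e1 := lit_eq_getElem h3 hj (p := 1) (by norm_num)
  have e2 := lit_eq_getElem h3 hj (p := 2) (by norm_num)
  simp only [Nat.add_zero] at e0
  simp only [habc, List.getElem_cons_zero, List.getElem_cons_succ] at e0 e1 e2
  rw [habc, ← e0, ← e1, ← e2]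

/-! ### Cyclic offsets and the next occurrence of the same variable -/

/-- Residues of numbers below `3K`. [folklore] -/
theorem mod_eq_of_lt_three_mul {x K : ℕ} (hx : x < 3 * K) :
    x % K = if x < K then x else if x < 2 * K then x - K else x - 2 * K := by
  split_ifs with h1 h2
  · exact Nat.mod_eq_of_lt h1
  · rw [Nat.mod_eq_sub_mod (by omega), Nat.mod_eq_of_lt (by omega)]
  · rw [Nat.mod_eq_sub_mod (by omega), Nat.mod_eq_sub_mod (by omega), Nat.mod_eq_of_lt (by omega)]
    omega

/-- The cyclic offset of position `x` from position `b` among `M` positions. [folklore] -/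
def off (φ : CNF ℕ) (b x : ℕ) : ℕ := (x + M φ - b) % M φ

/-- The positive cyclic offset of `a` from `b`, in `[1, M]` (`M` for `a = b`). [folklore] -/
def offP (φ : CNF ℕ) (b a : ℕ) : ℕ := (a + M φ - b - 1) % M φ + 1

/-- `d > 0` steps after `b` (cyclically) lies an occurrence of the variable of `b`. [folklore] -/
def StepP (φ : CNF ℕ) (b d : ℕ) : Prop := 0 < d ∧ var φ ((b + d) % M φ) = var φ b

/-- `StepP` is decidable. [folklore] -/
instance (b d : ℕ) : Decidable (StepP φ b d) := by unfold StepP; infer_instance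

/-- `M` steps after `b` lies `b` itself. [folklore] -/
theorem exists_stepP {b : ℕ} (hb : b < M φ) : ∃ d, StepP φ b d :=
  ⟨M φ, by omega, by rw [Nat.add_mod_right, Nat.mod_eq_of_lt hb]⟩

/-- **The next occurrence of the same variable**, cyclically (GJ's ring successor `a_i[j+1]`,
re-indexed by occurrences). [cite: GareyJohnson1979, Thm. 3.2 (proof, T_i^f)] -/
def next (φ : CNF ℕ) (b : ℕ) : ℕ := if hb : b < M φ then (b + Nat.find (exists_stepP hb)) % M φ else b

/-- **The machine form of `a = next b`**: `a` carries the variable of `b`, and no occurrence of that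
variable lies strictly between `b` and `a` in the cyclic order. [folklore] -/
def IsNext (φ : CNF ℕ) (a b : ℕ) : Prop :=
  var φ a = var φ b ∧ ∀ o < M φ, var φ o = var φ b → ¬ (0 < off φ b o ∧ off φ b o < offP φ b a)

section Offsets

variable {a b d o x : ℕ}

/-- Offsets are below `M`. [folklore] -/
theorem off_lt (hb : b < M φ) : off φ b x < M φ := Nat.mod_lt _ (by omega)

/-- `b` advanced by the offset of `x` is `x` (cyclically). [folklore] -/
theorem add_off_mod (hb : b < M φ) (hx : x < M φ) : (b + off φ b x) % M φ = x := by
  unfold off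
  rw [mod_eq_of_lt_three_mul (K := M φ) (x := x + M φ - b) (by omega)]
  split_ifs with h1 h2 <;> rw [mod_eq_of_lt_three_mul (K := M φ) (by omega)] <;> split_ifs <;> omega

/-- The offset of `b + d` from `b` is `d` (`d < M`). [folklore] -/
theorem off_add_mod (hb : b < M φ) (hd : d < M φ) : off φ b ((b + d) % M φ) = d := by
  unfold off
  rw [mod_eq_of_lt_three_mul (K := M φ) (x := b + d) (by omega)]
  split_ifs with h1 h2 <;> rw [mod_eq_of_lt_three_mul (K := M φ) (by omega)] <;> split_ifs <;> omega

/-- Offset zero means the same position. [folklore] -/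
theorem off_eq_zero_iff (hb : b < M φ) (hx : x < M φ) : off φ b x = 0 ↔ x = b := by
  constructor
  · intro h; have := add_off_mod hb hx; rw [h, Nat.add_zero, Nat.mod_eq_of_lt hb] at this; exact this.symm
  · intro h; rw [h]; unfold off; rw [show b + M φ - b = M φ by omega, Nat.mod_self]

/-- The positive offset of `b + d` from `b` is `d` (`0 < d ≤ M`). [folklore] -/
theorem offP_add_mod (hb : b < M φ) (hd0 : 0 < d) (hd : d ≤ M φ) : offP φ b ((b + d) % M φ) = d := by
  unfold offP
  rw [mod_eq_of_lt_three_mul (K := M φ) (x := b + d) (by omega)]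
  split_ifs with h1 h2 <;> rw [mod_eq_of_lt_three_mul (K := M φ) (by omega)] <;> split_ifs <;> omega

/-- `b` advanced by the positive offset of `a` is `a`. [folklore] -/
theorem add_offP_mod (hb : b < M φ) (ha : a < M φ) : (b + offP φ b a) % M φ = a := by
  unfold offP
  rw [mod_eq_of_lt_three_mul (K := M φ) (x := a + M φ - b - 1) (by omega)]
  split_ifs with h1 h2 <;> rw [mod_eq_of_lt_three_mul (K := M φ) (by omega)] <;> split_ifs <;> omega

/-- Positive offsets are positive. [folklore] -/
theorem offP_pos : 0 < offP φ b a := Nat.succ_pos _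

/-- Positive offsets are at most `M`. [folklore] -/
theorem offP_le (hb : b < M φ) : offP φ b a ≤ M φ := Nat.succ_le_of_lt (Nat.mod_lt _ (by omega))

/-- Offsets re-based: the offset of `x` from `(b + d) % M` is `off b x - d` when `d ≤ off b x`. [folklore] -/
theorem off_rebase (hb : b < M φ) (hx : x < M φ) (hd : d ≤ off φ b x) :
    off φ ((b + d) % M φ) x = off φ b x - d := by
  have hlt := off_lt (x := x) hb
  unfold off at hd hlt ⊢
  rw [mod_eq_of_lt_three_mul (K := M φ) (x := x + M φ - b) (by omega)] at hd hlt ⊢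
  rw [mod_eq_of_lt_three_mul (K := M φ) (x := b + d) (by omega)]
  split_ifs at hd hlt ⊢ <;> rw [mod_eq_of_lt_three_mul (K := M φ) (by omega)] <;> split_ifs <;> omega

end Offsets

section Next

variable {a b b' o : ℕ}

/-- Unfolding of `next` on an occurrence. [folklore] -/
theorem next_eq (hb : b < M φ) : next φ b = (b + Nat.find (exists_stepP hb)) % M φ := by
  rw [next, dif_pos hb]

/-- `next` is the identity out of range. [folklore] -/
theorem next_of_le (hb : M φ ≤ b) : next φ b = b := by
  rw [next, dif_neg (not_lt.2 hb)]

/-- The minimal step is positive. [folklore] -/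
theorem find_pos (hb : b < M φ) : 0 < Nat.find (exists_stepP hb) := (Nat.find_spec (exists_stepP hb)).1

/-- The minimal step is at most `M` (after `M` steps one is back at `b`). [folklore] -/
theorem find_le (hb : b < M φ) : Nat.find (exists_stepP hb) ≤ M φ :=
  Nat.find_min' _ ⟨by omega, by rw [Nat.add_mod_right, Nat.mod_eq_of_lt hb]⟩

/-- `next` of an occurrence is an occurrence. [folklore] -/
theorem next_lt (hb : b < M φ) : next φ b < M φ := by
  rw [next_eq hb]; exact Nat.mod_lt _ (by omega)

/-- `next` keeps the variable. [folklore] -/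
theorem var_next : var φ (next φ b) = var φ b := by
  by_cases hb : b < M φ
  · rw [next_eq hb]; exact (Nat.find_spec (exists_stepP hb)).2
  · rw [next, dif_neg hb]

/-- The positive offset of `next b` is the minimal step. [folklore] -/
theorem offP_next (hb : b < M φ) : offP φ b (next φ b) = Nat.find (exists_stepP hb) := by
  rw [next_eq hb, offP_add_mod hb (find_pos hb) (find_le hb)]

/-- **`next` is characterised by `IsNext`.** [folklore] -/
theorem isNext_iff (hb : b < M φ) (ha : a < M φ) : IsNext φ a b ↔ a = next φ b := by
  constructor
  · rintro ⟨hv, hno⟩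
    have hstep : StepP φ b (offP φ b a) := ⟨offP_pos, by rw [add_offP_mod hb ha, hv]⟩
    have hle : Nat.find (exists_stepP hb) ≤ offP φ b a := Nat.find_min' _ hstep
    rcases hle.lt_or_eq with hlt | heq
    · exfalso
      have hfM : Nat.find (exists_stepP hb) < M φ := lt_of_lt_of_le hlt (offP_le hb)
      refine hno (next φ b) (next_lt hb) var_next ⟨?_, ?_⟩
      · rw [next_eq hb, off_add_mod hb hfM]; exact find_pos hb
      · rw [next_eq hb, off_add_mod hb hfM]; exact hlt
    · rw [next_eq hb, heq, add_offP_mod hb ha]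
  · rintro rfl
    refine ⟨var_next, fun o ho hvo ⟨h0, h1⟩ => ?_⟩
    rw [offP_next hb] at h1
    have hstep : StepP φ b (off φ b o) := ⟨h0, by rw [add_off_mod hb ho, hvo]⟩
    exact absurd (Nat.find_min' _ hstep) (not_le.2 h1)

/-- **`next` is injective on occurrences.** [folklore] -/
theorem next_injective (hb : b < M φ) (hb' : b' < M φ) (h : next φ b = next φ b') : b = b' := by
  by_contra hne
  have hf0 : 0 < off φ b b' := Nat.pos_of_ne_zero fun h0 => hne ((off_eq_zero_iff hb hb').1 h0).symm
  have hfM : off φ b b' < M φ := off_lt hb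
  have hbf : (b + off φ b b') % M φ = b' := add_off_mod hb hb'
  have hvar : var φ b' = var φ b := by rw [← var_next (b := b'), ← h, var_next]
  have hd0 : 0 < Nat.find (exists_stepP hb) := find_pos hb
  have hdle : Nat.find (exists_stepP hb) ≤ off φ b b' := Nat.find_min' _ ⟨hf0, by rw [hbf, hvar]⟩
  have hd'0 : 0 < Nat.find (exists_stepP hb') := find_pos hb'
  have hd'M : Nat.find (exists_stepP hb') ≤ M φ := find_le hb'
  have hmin' : ∀ e, 0 < e → var φ ((b' + e) % M φ) = var φ b' → Nat.find (exists_stepP hb') ≤ e :=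
    fun e he hv => Nat.find_min' _ ⟨he, hv⟩
  have heq : (b + Nat.find (exists_stepP hb)) % M φ = (b' + Nat.find (exists_stepP hb')) % M φ := by
    rw [← next_eq hb, ← next_eq hb', h]
  generalize Nat.find (exists_stepP hb) = d at *
  generalize Nat.find (exists_stepP hb') = d' at *
  generalize off φ b b' = f at *
  subst hbf
  have hb'b : ((b + f) % M φ + (M φ - f)) % M φ = b := by
    rw [mod_eq_of_lt_three_mul (K := M φ) (x := b + f) (by omega)]
    split_ifs <;> rw [mod_eq_of_lt_three_mul (K := M φ) (by omega)] <;> split_ifs <;> omega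
  have hd'le : d' ≤ M φ - f := hmin' _ (by omega) (by rw [hb'b, hvar])
  rw [mod_eq_of_lt_three_mul (K := M φ) (x := b + f) (by omega)] at heq
  rw [mod_eq_of_lt_three_mul (K := M φ) (x := b + d) (by omega)] at heq
  split_ifs at heq <;> rw [mod_eq_of_lt_three_mul (K := M φ) (by omega)] at heq <;> split_ifs at heq <;> omega

/-- Iterates of `next` stay among the occurrences. [folklore] -/
theorem iterate_next_lt (hb : b < M φ) : ∀ k, (next φ)^[k] b < M φ
  | 0 => hb
  | k + 1 => by rw [Function.iterate_succ_apply']; exact next_lt (iterate_next_lt hb k)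

/-- Iterates of `next` keep the variable. [folklore] -/
theorem var_iterate_next : ∀ k, var φ ((next φ)^[k] b) = var φ b
  | 0 => rfl
  | k + 1 => by rw [Function.iterate_succ_apply', var_next, var_iterate_next k]

/-- **Every occurrence of the variable of `b` is an iterated successor of `b`** (the ring of a
variable passes through all its occurrences). [cite: GareyJohnson1979, Thm. 3.2 (proof, T_i)] -/
theorem exists_iterate_next_eq : ∀ (e : ℕ) {b : ℕ}, b < M φ → o < M φ → var φ o = var φ b →
    off φ b o = e → ∃ k, (next φ)^[k] b = o := by
  intro e
  induction e using Nat.strong_induction_on with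
  | _ e ih =>
    intro b hb ho hv he
    rcases Nat.eq_zero_or_pos e with rfl | hpos
    · exact ⟨0, ((off_eq_zero_iff hb ho).1 he).symm⟩
    · have hstep : StepP φ b e := ⟨hpos, by rw [← he, add_off_mod hb ho, hv]⟩
      have hdle : Nat.find (exists_stepP hb) ≤ e := Nat.find_min' _ hstep
      have hd0 : 0 < Nat.find (exists_stepP hb) := find_pos hb
      have hoff : off φ (next φ b) o = e - Nat.find (exists_stepP hb) := by
        rw [next_eq hb, off_rebase hb ho (he ▸ hdle), he]
      obtain ⟨k, hk⟩ := ih (e - Nat.find (exists_stepP hb)) (by omega) (next_lt hb) ho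
        (by rw [hv, var_next]) hoff
      exact ⟨k + 1, by rw [Function.iterate_succ_apply]; exact hk⟩

/-- **A property invariant under `next` is constant on the occurrences of each variable.** [folklore] -/
theorem iff_of_next_invariant {T : ℕ → Prop} (hT : ∀ o < M φ, (T o ↔ T (next φ o))) (hb : b < M φ)
    (ho : o < M φ) (hv : var φ o = var φ b) : (T b ↔ T o) := by
  obtain ⟨k, rfl⟩ := exists_iterate_next_eq (off φ b o) hb ho hv rfl
  clear hv ho
  induction k with
  | zero => rfl
  | succ k ih =>
    rw [Function.iterate_succ_apply']
    exact ih.trans (hT _ (iterate_next_lt hb k))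

end Next

/-! ### Tips, selectors, the instance -/

/-- The tip `2o + b` of occurrence `o`: `b = false` is GJ's external element `u[j]`, `b = true` is
`ū[j]`. [cite: GareyJohnson1979, Thm. 3.2 (proof)] -/
def tip (o : ℕ) (b : Bool) : ℕ := 2 * o + b.toNat

/-- `tip` is injective. [folklore] -/
theorem tip_inj {o o' : ℕ} {b b' : Bool} : tip o b = tip o' b' ↔ o = o' ∧ b = b' := by
  cases b <;> cases b' <;> simp [tip] <;> omega

/-- Tips of occurrences are below `q`. [folklore] -/
theorem tip_lt_q {o : ℕ} (b : Bool) (ho : o < M φ) : tip o b < q φ := by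
  have hq := q_eq φ
  cases b <;> simp [tip] <;> omega

/-- The tip a selector of kind `s` grabs at occurrence `o`: the TRUE tip `tip o (¬ pol o)` for the
satisfaction selector `s = 0`, the FALSE tip `tip o (pol o)` for the two falsity selectors `s = 1, 2`.
[folklore] -/
def tipFor (φ : CNF ℕ) (s o : ℕ) : ℕ := if s = 0 then tip o (!pol φ o) else tip o (pol φ o)

/-- The selector triples with first and second coordinate `b ≥ M`, `b - M = 3j + s`: third coordinate
`tipFor s (3j + p)` for one of the three occurrences `p < 3` of clause `j`. [folklore] -/
def SelP (φ : CNF ℕ) (b c : ℕ) : Prop :=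
  c = tipFor φ ((b - M φ) % 3) (3 * ((b - M φ) / 3)) ∨ c = tipFor φ ((b - M φ) % 3) (3 * ((b - M φ) / 3) + 1) ∨
    c = tipFor φ ((b - M φ) % 3) (3 * ((b - M φ) / 3) + 2)

/-- **The triple set of the instance**, as a predicate on coordinates `(a, b, c)`: the ring triples
`t_b = (b, b, tip b true)`, `f_b = (next b, b, tip b false)` for occurrences `b < M`, and the selector
triples for `b ≥ M`. [cite: GareyJohnson1979, Thm. 3.2 (proof)] -/
def P (φ : CNF ℕ) (a b c : ℕ) : Prop :=
  (b < M φ ∧ ((a = b ∧ c = tip b true) ∨ (a = next φ b ∧ c = tip b false))) ∨ (M φ ≤ b ∧ a = b ∧ SelP φ b c)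

/-- The triple predicate is decidable. [folklore] -/
instance (a b c : ℕ) : Decidable (P φ a b c) := by unfold P SelP; infer_instance

/-- The triple set `U ⊆ T × T × T`, `T = Fin q`. [cite: GareyJohnson1979, Thm. 3.2 (proof)] -/
def U (φ : CNF ℕ) : Finset (Fin (q φ) × Fin (q φ) × Fin (q φ)) :=
  Finset.univ.filter fun t => P φ t.1 t.2.1 t.2.2

/-- **The 3DM instance `⟨q, U⟩` of a clause list.** [cite: GareyJohnson1979, Thm. 3.2 (proof)] -/
def inst (φ : CNF ℕ) : Σ n, Finset (Fin n × Fin n × Fin n) := ⟨q φ, U φ⟩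

/-- Membership in `U`. [folklore] -/
theorem mem_U_iff (t : Fin (q φ) × Fin (q φ) × Fin (q φ)) : t ∈ U φ ↔ P φ t.1 t.2.1 t.2.2 := by
  simp [U]

/-- Membership of the instance in `threeDMSet`, unfolded. [cite: Karp1972, §3  problem 17] -/
theorem inst_mem_threeDMSet_iff :
    inst φ ∈ threeDMSet ↔ ∃ W ⊆ U φ, W.card = q φ ∧ IsThreeDMatching W := Iff.rfl

/-! ### Exactly one true literal among three -/

/-- Position of the true literal. [folklore] -/
def pos0 (e : ℕ → Bool) : ℕ := if e 0 then 0 else if e 1 then 1 else 2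
/-- Position of the first false literal. [folklore] -/
def pos1 (e : ℕ → Bool) : ℕ := if e 0 then 1 else 0
/-- Position of the second false literal. [folklore] -/
def pos2 (e : ℕ → Bool) : ℕ := if e 2 then 1 else 2
/-- The position served by selector `s`. [folklore] -/
def selPos (e : ℕ → Bool) (s : ℕ) : ℕ := if s = 0 then pos0 e else if s = 1 then pos1 e else pos2 e

/-- The count of true values among three. [folklore] -/
def cnt3 (e : ℕ → Bool) : ℕ := (if e 0 = true then 1 else 0) + (if e 1 = true then 1 else 0) + (if e 2 = true then 1 else 0)

/-- `countP` over a three-element list. [folklore] -/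
theorem countP_three {α : Type} (f : α → Bool) (a b c : α) :
    [a, b, c].countP f = (if f a = true then 1 else 0) + (if f b = true then 1 else 0) + (if f c = true then 1 else 0) := by
  simp only [List.countP_cons, List.countP_nil]
  omega

/-- With exactly one true value among three: `pos0` is true, `pos1`, `pos2` are false, and the three
positions are pairwise distinct. [folklore] -/
theorem selPos_spec {e : ℕ → Bool} (h : cnt3 e = 1) :
    e (pos0 e) = true ∧ e (pos1 e) = false ∧ e (pos2 e) = false ∧
      pos0 e ≠ pos1 e ∧ pos0 e ≠ pos2 e ∧ pos1 e ≠ pos2 e := by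
  unfold cnt3 at h
  cases h0 : e 0 <;> cases h1 : e 1 <;> cases h2 : e 2 <;> simp_all [pos0, pos1, pos2]

/-- Selector positions are below `3`. [folklore] -/
theorem selPos_lt (e : ℕ → Bool) (s : ℕ) : selPos e s < 3 := by
  unfold selPos pos0 pos1 pos2; split_ifs <;> norm_num

/-- Selector `0` serves the true position. [folklore] -/
theorem selPos_true {e : ℕ → Bool} (h : cnt3 e = 1) : e (selPos e 0) = true := (selPos_spec h).1

/-- Selectors `1, 2` serve false positions. [folklore] -/
theorem selPos_false {e : ℕ → Bool} (h : cnt3 e = 1) {s : ℕ} (hs : s ≠ 0) : e (selPos e s) = false := by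
  unfold selPos; rw [if_neg hs]
  split_ifs
  · exact (selPos_spec h).2.1
  · exact (selPos_spec h).2.2.1

/-- Distinct selectors serve distinct positions. [folklore] -/
theorem selPos_injective {e : ℕ → Bool} (h : cnt3 e = 1) {s s' : ℕ} (hs : s < 3) (hs' : s' < 3)
    (hss : selPos e s = selPos e s') : s = s' := by
  have hsp := selPos_spec h
  unfold selPos at hss
  rcases (by omega : s = 0 ∨ s = 1 ∨ s = 2) with rfl | rfl | rfl <;>
    rcases (by omega : s' = 0 ∨ s' = 1 ∨ s' = 2) with rfl | rfl | rfl <;> simp_all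

/-- Conversely: one true position and two false ones, pairwise distinct, give count one. [folklore] -/
theorem cnt3_eq_one {e : ℕ → Bool} {p0 p1 p2 : ℕ} (h0 : p0 < 3) (h1 : p1 < 3) (h2 : p2 < 3)
    (h01 : p0 ≠ p1) (h02 : p0 ≠ p2) (h12 : p1 ≠ p2) (e0 : e p0 = true) (e1 : e p1 = false) (e2 : e p2 = false) :
    cnt3 e = 1 := by
  unfold cnt3
  rcases (by omega : p0 = 0 ∨ p0 = 1 ∨ p0 = 2) with rfl | rfl | rfl <;>
    rcases (by omega : p1 = 0 ∨ p1 = 1 ∨ p1 = 2) with rfl | rfl | rfl <;>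
      rcases (by omega : p2 = 0 ∨ p2 = 1 ∨ p2 = 2) with rfl | rfl | rfl <;> simp_all



/-! ### Completeness: an exactly-one assignment gives a perfect matching -/

section Completeness

variable {σ : ℕ → Bool}

/-- The mode of an occurrence under `σ`: the value of its variable. [folklore] -/
def mode (φ : CNF ℕ) (σ : ℕ → Bool) (o : ℕ) : Bool := σ (var φ o)

/-- The value of the literal of an occurrence under `σ`. [folklore] -/
def ev (φ : CNF ℕ) (σ : ℕ → Bool) (o : ℕ) : Bool := Literal.eval σ (lit φ o)

/-- The value of a literal is the comparison of its mode with its polarity. [folklore] -/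
theorem ev_eq (o : ℕ) : ev φ σ o = (mode φ σ o == pol φ o) := rfl

/-- The occurrence served by the selector `r = 3j + s` (`j = r / 3`, `s = r % 3`). [folklore] -/
def selOcc (φ : CNF ℕ) (σ : ℕ → Bool) (r : ℕ) : ℕ := 3 * (r / 3) + selPos (fun p => ev φ σ (3 * (r / 3) + p)) (r % 3)

/-- First coordinate of the matching triple with second coordinate `i`. [folklore] -/
def cA (φ : CNF ℕ) (σ : ℕ → Bool) (i : ℕ) : ℕ :=
  if i < M φ then (if mode φ σ i then i else next φ i) else i

/-- The occurrence whose tip is the third coordinate of the matching triple with second coordinate `i`. [folklore] -/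
def cOcc (φ : CNF ℕ) (σ : ℕ → Bool) (i : ℕ) : ℕ := if i < M φ then i else selOcc φ σ (i - M φ)

/-- The tip bit of that third coordinate: ring triples take the COVERED tip `tip o (mode o)`, selectors
the FREE tip `tip o (¬ mode o)`. [folklore] -/
def cBit (φ : CNF ℕ) (σ : ℕ → Bool) (i : ℕ) : Bool := if i < M φ then mode φ σ i else !mode φ σ (cOcc φ σ i)

/-- Third coordinate of the matching triple with second coordinate `i`. [folklore] -/
def cC (φ : CNF ℕ) (σ : ℕ → Bool) (i : ℕ) : ℕ := tip (cOcc φ σ i) (cBit φ σ i)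

/-- Served occurrences are occurrences. [folklore] -/
theorem selOcc_lt {r : ℕ} (hr : r < M φ) : selOcc φ σ r < M φ := by
  have := selPos_lt (fun p => ev φ σ (3 * (r / 3) + p)) (r % 3)
  have hM := M_eq φ
  unfold selOcc; omega

/-- `cOcc` is an occurrence. [folklore] -/
theorem cOcc_lt {i : ℕ} (hi : i < q φ) : cOcc φ σ i < M φ := by
  have hq := q_eq φ
  unfold cOcc; split_ifs with h
  · exact h
  · exact selOcc_lt (by omega)

/-- `cA` is a coordinate. [folklore] -/
theorem cA_lt {i : ℕ} (hi : i < q φ) : cA φ σ i < q φ := by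
  have hq := q_eq φ
  unfold cA; split_ifs with h1 h2
  · exact hi
  · exact (next_lt h1).trans_le (by omega)
  · exact hi

/-- `cC` is a coordinate. [folklore] -/
theorem cC_lt {i : ℕ} (hi : i < q φ) : cC φ σ i < q φ := tip_lt_q _ (cOcc_lt hi)

/-- Exactly one true literal per clause, in terms of `ev`. [folklore] -/
theorem cnt3_ev (h3 : ∀ c ∈ φ, c.length = 3) (hσ : φ.xeval σ = true) {j : ℕ} (hj : j < φ.length) :
    cnt3 (fun p => ev φ σ (3 * j + p)) = 1 := by
  rw [CNF.xeval_eq_true_iff] at hσ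
  have h := hσ _ (List.getElem_mem hj)
  rw [getElem_eq_lits h3 hj, countP_three] at h
  exact h

/-- The selector of kind `s = r % 3` serves a true literal iff `s = 0`. [folklore] -/
theorem ev_selOcc {r : ℕ} (hc : cnt3 (fun p => ev φ σ (3 * (r / 3) + p)) = 1) :
    ev φ σ (selOcc φ σ r) = decide (r % 3 = 0) := by
  unfold selOcc
  by_cases hs : r % 3 = 0
  · rw [hs, decide_eq_true rfl]; exact selPos_true hc
  · rw [decide_eq_false hs]; exact selPos_false hc hs

/-- The free tip of an occurrence is the tip its selector wants. [folklore] -/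
theorem tip_not_mode_eq_tipFor {o s : ℕ} (h : ev φ σ o = decide (s = 0)) :
    tip o (!mode φ σ o) = tipFor φ s o := by
  unfold tipFor
  rw [ev_eq] at h
  by_cases hs : s = 0
  · rw [if_pos hs]; rw [hs, decide_eq_true rfl] at h
    revert h; cases mode φ σ o <;> cases pol φ o <;> simp
  · rw [if_neg hs]; rw [decide_eq_false hs] at h
    revert h; cases mode φ σ o <;> cases pol φ o <;> simp

/-- **The matching triples are triples of the instance.** [cite: GareyJohnson1979, Thm. 3.2 (proof)] -/
theorem P_cA_cC (h3 : ∀ c ∈ φ, c.length = 3) (hσ : φ.xeval σ = true) {i : ℕ} (hi : i < q φ) :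
    P φ (cA φ σ i) i (cC φ σ i) := by
  by_cases hiM : i < M φ
  · left
    refine ⟨hiM, ?_⟩
    simp only [cA, cC, cOcc, cBit, if_pos hiM]
    cases mode φ σ i
    · right; exact ⟨rfl, rfl⟩
    · left; exact ⟨rfl, rfl⟩
  · right
    refine ⟨not_lt.1 hiM, by simp [cA, hiM], ?_⟩
    have hM := M_eq φ
    have hq := q_eq φ
    have hr : i - M φ < M φ := by omega
    have hj : (i - M φ) / 3 < φ.length := by omega
    have hc := cnt3_ev h3 hσ hj
    have key : cC φ σ i = tipFor φ ((i - M φ) % 3) (selOcc φ σ (i - M φ)) := by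
      simp only [cC, cOcc, cBit, if_neg hiM]
      exact tip_not_mode_eq_tipFor (ev_selOcc hc)
    rw [key]
    unfold SelP selOcc
    have hlt := selPos_lt (fun p => ev φ σ (3 * ((i - M φ) / 3) + p)) ((i - M φ) % 3)
    rcases (by omega : selPos (fun p => ev φ σ (3 * ((i - M φ) / 3) + p)) ((i - M φ) % 3) = 0 ∨
        selPos (fun p => ev φ σ (3 * ((i - M φ) / 3) + p)) ((i - M φ) % 3) = 1 ∨
        selPos (fun p => ev φ σ (3 * ((i - M φ) / 3) + p)) ((i - M φ) % 3) = 2) with h | h | h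
    · left; rw [h, Nat.add_zero]
    · right; left; rw [h]
    · right; right; rw [h]

/-- **First coordinates of the matching are pairwise distinct.** [cite: GareyJohnson1979, Thm. 3.2 (proof)] -/
theorem cA_injective {i i' : ℕ} (h : cA φ σ i = cA φ σ i') : i = i' := by
  unfold cA at h
  by_cases hiM : i < M φ <;> by_cases hiM' : i' < M φ <;> simp only [hiM, hiM', if_true, if_false] at h
  · -- both occurrences
    cases hm : mode φ σ i <;> cases hm' : mode φ σ i' <;> simp only [hm, hm', if_true, if_false, Bool.false_eq_true] at h
    · exact next_injective hiM hiM' h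
    · exfalso
      have : mode φ σ i = mode φ σ i' := by unfold mode; rw [← var_next (b := i), h]
      rw [hm, hm'] at this; exact Bool.false_ne_true this
    · exfalso
      have : mode φ σ i = mode φ σ i' := by unfold mode; rw [← var_next (b := i'), h]
      rw [hm, hm'] at this; exact Bool.false_ne_true this.symm
    · exact h
  · exfalso
    have : (if mode φ σ i then i else next φ i) < M φ := by split_ifs; exacts [hiM, next_lt hiM]
    omega
  · exfalso
    have : (if mode φ σ i' then i' else next φ i') < M φ := by split_ifs; exacts [hiM', next_lt hiM']
    omega
  · exact h

/-- **Third coordinates of the matching are pairwise distinct.** [cite: GareyJohnson1979, Thm. 3.2 (proof)] -/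
theorem cC_injective (h3 : ∀ c ∈ φ, c.length = 3) (hσ : φ.xeval σ = true) {i i' : ℕ} (hi : i < q φ)
    (hi' : i' < q φ) (h : cC φ σ i = cC φ σ i') : i = i' := by
  unfold cC at h
  obtain ⟨ho, hb⟩ := tip_inj.1 h
  simp only [cOcc, cBit] at ho hb
  by_cases hiM : i < M φ <;> by_cases hiM' : i' < M φ <;> simp only [hiM, hiM', if_true, if_false] at ho hb
  · exact ho
  · exfalso; rw [ho] at hb; cases mode φ σ (selOcc φ σ (i' - M φ)) <;> simp at hb
  · exfalso; rw [← ho] at hb; cases mode φ σ (selOcc φ σ (i - M φ)) <;> simp at hb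
  · -- two selectors
    have hM := M_eq φ
    have hq := q_eq φ
    have hr : i - M φ < M φ := by omega
    have hr' : i' - M φ < M φ := by omega
    unfold selOcc at ho
    have hl := selPos_lt (fun p => ev φ σ (3 * ((i - M φ) / 3) + p)) ((i - M φ) % 3)
    have hl' := selPos_lt (fun p => ev φ σ (3 * ((i' - M φ) / 3) + p)) ((i' - M φ) % 3)
    have hj : (i - M φ) / 3 = (i' - M φ) / 3 := by omega
    rw [hj] at ho
    have hs : (i - M φ) % 3 = (i' - M φ) % 3 :=
      selPos_injective (cnt3_ev h3 hσ (j := (i' - M φ) / 3) (by omega)) (Nat.mod_lt _ (by norm_num))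
        (Nat.mod_lt _ (by norm_num)) (by simpa using ho)
    omega

/-- **Completeness of the gadget**: an assignment with exactly one true literal per clause yields a
perfect matching (no garbage collection is needed: every tip is taken either by its ring or by one of
the three selectors of its clause). [cite: GareyJohnson1979, Thm. 3.2 (proof, last paragraph)] -/
theorem mem_threeDMSet_of_xSatisfiable (h3 : ∀ c ∈ φ, c.length = 3) (hx : φ.XSatisfiable) :
    inst φ ∈ threeDMSet := by
  classical
  rw [inst_mem_threeDMSet_iff]
  obtain ⟨σ, hσ⟩ := hx
  let g : Fin (q φ) → Fin (q φ) × Fin (q φ) × Fin (q φ) := fun i =>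
    (⟨cA φ σ i, cA_lt i.2⟩, i, ⟨cC φ σ i, cC_lt i.2⟩)
  have hg : Function.Injective g := fun i i' h => by simpa [g] using congrArg (fun t => t.2.1) h
  refine ⟨Finset.univ.image g, ?_, ?_, ?_⟩
  · intro t ht
    obtain ⟨i, -, rfl⟩ := Finset.mem_image.1 ht
    rw [mem_U_iff]
    exact P_cA_cC h3 hσ i.2
  · rw [Finset.card_image_of_injective _ hg, Finset.card_univ, Fintype.card_fin]
  · intro s hs t ht hst
    obtain ⟨i, -, rfl⟩ := Finset.mem_image.1 hs
    obtain ⟨i', -, rfl⟩ := Finset.mem_image.1 ht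
    have hii' : (i : ℕ) ≠ i' := fun h => hst (by rw [Fin.ext h])
    refine ⟨fun h => hii' (cA_injective (Fin.mk.inj_iff.1 h)), fun h => hii' (congrArg Fin.val h),
      fun h => hii' (cC_injective h3 hσ i.2 i'.2 (Fin.mk.inj_iff.1 h))⟩

end Completeness

/-! ### Soundness: a perfect matching gives an exactly-one assignment -/

section Soundness

variable {W : Finset (Fin (q φ) × Fin (q φ) × Fin (q φ))} {a a' b b' c c' o : ℕ}

/-- `(a, b, c) ∈ W`, on natural-number coordinates. [folklore] -/
def MemW (W : Finset (Fin (q φ) × Fin (q φ) × Fin (q φ))) (a b c : ℕ) : Prop :=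
  ∃ t ∈ W, (t.1 : ℕ) = a ∧ (t.2.1 : ℕ) = b ∧ (t.2.2 : ℕ) = c

/-- Triples of `W ⊆ U` satisfy the triple predicate. [folklore] -/
theorem MemW.P (hWU : W ⊆ U φ) (h : MemW W a b c) : P φ a b c := by
  obtain ⟨t, ht, rfl, rfl, rfl⟩ := h
  exact (mem_U_iff t).1 (hWU ht)

/-- Coordinates of triples of `W` are below `q`. [folklore] -/
theorem MemW.lt (h : MemW W a b c) : a < q φ ∧ b < q φ ∧ c < q φ := by
  obtain ⟨t, -, rfl, rfl, rfl⟩ := h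
  exact ⟨t.1.2, t.2.1.2, t.2.2.2⟩

/-- In a perfect matching every value occurs as a first coordinate. [folklore] -/
theorem exists_memW_fst (hc : W.card = q φ) (hm : IsThreeDMatching W) (ha : a < q φ) : ∃ b c, MemW W a b c := by
  classical
  have hinj : Set.InjOn (fun t : Fin (q φ) × Fin (q φ) × Fin (q φ) => t.1) ↑W := by
    intro s hs t ht h
    by_contra hne
    exact (hm hs ht hne).1 h
  have huniv : W.image (fun t => t.1) = Finset.univ :=
    Finset.eq_univ_of_card _ (by rw [Finset.card_image_of_injOn hinj, hc, Fintype.card_fin])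
  have hmem : (⟨a, ha⟩ : Fin (q φ)) ∈ W.image (fun t => t.1) := huniv ▸ Finset.mem_univ _
  obtain ⟨t, ht, hta⟩ := Finset.mem_image.1 hmem
  exact ⟨t.2.1, t.2.2, t, ht, by rw [hta], rfl, rfl⟩

/-- In a perfect matching every value occurs as a second coordinate. [folklore] -/
theorem exists_memW_snd (hc : W.card = q φ) (hm : IsThreeDMatching W) (hb : b < q φ) : ∃ a c, MemW W a b c := by
  classical
  have hinj : Set.InjOn (fun t : Fin (q φ) × Fin (q φ) × Fin (q φ) => t.2.1) ↑W := by
    intro s hs t ht h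
    by_contra hne
    exact (hm hs ht hne).2.1 h
  have huniv : W.image (fun t => t.2.1) = Finset.univ :=
    Finset.eq_univ_of_card _ (by rw [Finset.card_image_of_injOn hinj, hc, Fintype.card_fin])
  have hmem : (⟨b, hb⟩ : Fin (q φ)) ∈ W.image (fun t => t.2.1) := huniv ▸ Finset.mem_univ _
  obtain ⟨t, ht, htb⟩ := Finset.mem_image.1 hmem
  exact ⟨t.1, t.2.2, t, ht, rfl, by rw [htb], rfl⟩

/-- In a matching a triple is determined by its first coordinate. [folklore] -/
theorem MemW.uniq_fst (hm : IsThreeDMatching W) (h : MemW W a b c) (h' : MemW W a b' c') : b = b' ∧ c = c' := by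
  obtain ⟨s, hs, rfl, rfl, rfl⟩ := h
  obtain ⟨t, ht, hst, rfl, rfl⟩ := h'
  by_cases hq : s = t
  · subst hq; exact ⟨rfl, rfl⟩
  · exact absurd (Fin.ext hst).symm (hm hs ht hq).1

/-- In a matching a triple is determined by its second coordinate. [folklore] -/
theorem MemW.uniq_snd (hm : IsThreeDMatching W) (h : MemW W a b c) (h' : MemW W a' b c') : a = a' ∧ c = c' := by
  obtain ⟨s, hs, rfl, rfl, rfl⟩ := h
  obtain ⟨t, ht, rfl, hst, rfl⟩ := h'
  by_cases hq : s = t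
  · subst hq; exact ⟨rfl, rfl⟩
  · exact absurd (Fin.ext hst).symm (hm hs ht hq).2.1

/-- In a matching a triple is determined by its third coordinate. [folklore] -/
theorem MemW.uniq_thd (hm : IsThreeDMatching W) (h : MemW W a b c) (h' : MemW W a' b' c) : a = a' ∧ b = b' := by
  obtain ⟨s, hs, rfl, rfl, rfl⟩ := h
  obtain ⟨t, ht, rfl, rfl, hst⟩ := h'
  by_cases hq : s = t
  · subst hq; exact ⟨rfl, rfl⟩
  · exact absurd (Fin.ext hst).symm (hm hs ht hq).2.2

/-- **The ring alternative**: for each occurrence `o`, the matching contains `t_o` or `f_o`.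
[cite: GareyJohnson1979, Thm. 3.2 (proof, "either all triples in T_i^t or all triples in T_i^f")] -/
theorem ring_cases (hWU : W ⊆ U φ) (hc : W.card = q φ) (hm : IsThreeDMatching W) (ho : o < M φ) :
    MemW W o o (tip o true) ∨ MemW W (next φ o) o (tip o false) := by
  have hq := q_eq φ
  obtain ⟨a, c, h⟩ := exists_memW_snd hc hm (b := o) (by omega)
  rcases h.P hWU with ⟨-, ⟨rfl, rfl⟩ | ⟨rfl, rfl⟩⟩ | ⟨hMo, -, -⟩
  · exact Or.inl h
  · exact Or.inr h
  · omega

/-- `t_o` and `f_o` share the second coordinate `o`, so a matching never contains both. [folklore] -/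
theorem not_both (hm : IsThreeDMatching W) (h1 : MemW W o o (tip o true)) (h2 : MemW W (next φ o) o (tip o false)) :
    False := by
  have := (h1.uniq_snd hm h2).2
  rw [tip_inj] at this
  exact Bool.noConfusion this.2

/-- **Ring consistency**: `t_o ∈ W ↔ t_{next o} ∈ W`. [cite: GareyJohnson1979, Thm. 3.2 (proof)] -/
theorem ring_step (hWU : W ⊆ U φ) (hc : W.card = q φ) (hm : IsThreeDMatching W) (ho : o < M φ) :
    MemW W o o (tip o true) ↔ MemW W (next φ o) (next φ o) (tip (next φ o) true) := by
  have hq := q_eq φ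
  have hn := next_lt (φ := φ) ho
  constructor
  · intro hT
    obtain ⟨b, c, h⟩ := exists_memW_fst hc hm (a := next φ o) (by omega)
    rcases h.P hWU with ⟨hb, ⟨hab, rfl⟩ | ⟨hab, rfl⟩⟩ | ⟨hMb, hab, -⟩
    · subst hab; exact h
    · have hbo : b = o := (next_injective hb ho hab.symm)
      subst hbo
      exact (not_both hm hT h).elim
    · omega
  · intro hT'
    rcases ring_cases hWU hc hm ho with h | h
    · exact h
    · have := (hT'.uniq_fst hm h)
      rw [tip_inj] at this
      exact absurd this.2.2 (by simp)

/-- **Soundness of the gadget**: a perfect matching of the instance yields an assignment with exactly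
one true literal in every clause. [cite: GareyJohnson1979, Thm. 3.2 (proof)] -/
theorem xSatisfiable_of_mem_threeDMSet (h3 : ∀ c ∈ φ, c.length = 3) (h : inst φ ∈ threeDMSet) :
    φ.XSatisfiable := by
  classical
  rw [inst_mem_threeDMSet_iff] at h
  obtain ⟨W, hWU, hc, hm⟩ := h
  have hM := M_eq φ
  have hq := q_eq φ
  -- the mode of an occurrence: `t_o ∈ W`
  let Tm : ℕ → Prop := fun o => MemW W o o (tip o true)
  have hstep : ∀ o < M φ, (Tm o ↔ Tm (next φ o)) := fun o ho => ring_step hWU hc hm ho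
  -- the assignment
  let σ : ℕ → Bool := fun v => decide (∃ o, o < M φ ∧ var φ o = v ∧ Tm o)
  have hσ : ∀ o < M φ, (σ (var φ o) = true ↔ Tm o) := by
    intro o ho
    simp only [σ, decide_eq_true_eq]
    constructor
    · rintro ⟨o', ho', hv, hT'⟩
      exact (iff_of_next_invariant hstep ho' ho hv.symm).1 hT'
    · intro hT; exact ⟨o, ho, rfl, hT⟩
  have hmode : ∀ o < M φ, mode φ σ o = decide (Tm o) := by
    intro o ho
    show σ (var φ o) = decide (Tm o)
    rw [Bool.eq_iff_iff]
    exact (hσ o ho).trans decide_eq_true_iff.symm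
  -- the ring tip of each occurrence
  have hring : ∀ o < M φ, ∃ a, MemW W a o (tip o (mode φ σ o)) := by
    intro o ho
    rw [hmode o ho]
    by_cases hT : Tm o
    · rw [decide_eq_true hT]; exact ⟨o, hT⟩
    · rw [decide_eq_false hT]
      rcases ring_cases hWU hc hm ho with h | h
      · exact absurd h hT
      · exact ⟨_, h⟩
  -- the selector triples
  have hsel : ∀ j < φ.length, ∀ s < 3, ∃ p < 3,
      MemW W (M φ + 3 * j + s) (M φ + 3 * j + s) (tipFor φ s (3 * j + p)) := by
    intro j hj s hs
    obtain ⟨b, c, h⟩ := exists_memW_fst hc hm (a := M φ + 3 * j + s) (by omega)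
    rcases h.P hWU with ⟨hb, ⟨hab, rfl⟩ | ⟨hab, rfl⟩⟩ | ⟨-, hab, hS⟩
    · omega
    · have := next_lt (φ := φ) hb; omega
    · subst hab
      have e1 : (M φ + 3 * j + s - M φ) % 3 = s := by omega
      have e2 : 3 * ((M φ + 3 * j + s - M φ) / 3) = 3 * j := by omega
      simp only [SelP, e1, e2] at hS
      rcases hS with rfl | rfl | rfl
      · exact ⟨0, by norm_num, by simpa using h⟩
      · exact ⟨1, by norm_num, h⟩
      · exact ⟨2, by norm_num, h⟩
  -- a selector's tip is never its occurrence's ring tip: the literal values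
  have hval : ∀ j < φ.length, ∀ s < 3, ∀ p < 3,
      MemW W (M φ + 3 * j + s) (M φ + 3 * j + s) (tipFor φ s (3 * j + p)) → ev φ σ (3 * j + p) = decide (s = 0) := by
    intro j hj s hs p hp hW
    have ho : 3 * j + p < M φ := by omega
    obtain ⟨a, ha⟩ := hring _ ho
    have hne : tipFor φ s (3 * j + p) ≠ tip (3 * j + p) (mode φ σ (3 * j + p)) := by
      intro heq
      rw [heq] at hW
      have := (hW.uniq_thd hm ha).2
      omega
    rw [ev_eq]
    unfold tipFor at hne
    by_cases hs0 : s = 0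
    · rw [if_pos hs0] at hne; rw [hs0, decide_eq_true rfl]
      revert hne; cases mode φ σ (3 * j + p) <;> cases pol φ (3 * j + p) <;> simp
    · rw [if_neg hs0] at hne; rw [decide_eq_false hs0]
      revert hne; cases mode φ σ (3 * j + p) <;> cases pol φ (3 * j + p) <;> simp
  -- exactly one true literal per clause
  refine ⟨σ, ?_⟩
  rw [CNF.xeval_eq_true_iff]
  intro cl hcl
  obtain ⟨j, hj, rfl⟩ := List.mem_iff_getElem.1 hcl
  rw [getElem_eq_lits h3 hj, countP_three]
  obtain ⟨p0, hp0, hW0⟩ := hsel j hj 0 (by norm_num)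
  obtain ⟨p1, hp1, hW1⟩ := hsel j hj 1 (by norm_num)
  obtain ⟨p2, hp2, hW2⟩ := hsel j hj 2 (by norm_num)
  have e0 := hval j hj 0 (by norm_num) p0 hp0 hW0
  have e1 := hval j hj 1 (by norm_num) p1 hp1 hW1
  have e2 := hval j hj 2 (by norm_num) p2 hp2 hW2
  simp only [decide_true, Nat.one_ne_zero, decide_false, OfNat.ofNat_ne_zero] at e0 e1 e2
  have h01 : p0 ≠ p1 := by rintro rfl; rw [e0] at e1; exact Bool.noConfusion e1
  have h02 : p0 ≠ p2 := by rintro rfl; rw [e0] at e2; exact Bool.noConfusion e2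
  have h12 : p1 ≠ p2 := by
    rintro rfl
    have ht : tipFor φ 1 (3 * j + p1) = tipFor φ 2 (3 * j + p1) := by simp [tipFor]
    rw [ht] at hW1
    have := (hW1.uniq_thd hm hW2).1
    omega
  exact cnt3_eq_one (e := fun p => ev φ σ (3 * j + p)) hp0 hp1 hp2 h01 h02 h12 e0 e1 e2

/-- **The gadget is correct**: for a list of three-literal clauses, ONE-IN-THREE satisfiability is
equivalent to the existence of a perfect 3-dimensional matching in `⟨q, U⟩`.
[cite: GareyJohnson1979, Thm. 3.2] -/
theorem xSatisfiable_iff_mem_threeDMSet (h3 : ∀ c ∈ φ, c.length = 3) :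
    φ.XSatisfiable ↔ inst φ ∈ threeDMSet :=
  ⟨mem_threeDMSet_of_xSatisfiable h3, xSatisfiable_of_mem_threeDMSet h3⟩

end Soundness

/-! ### Machine-side forms: the triple predicate without `Nat.find`, and the code of the instance -/

/-- **The triple predicate in machine form**: `a = next b` replaced by the bounded test `IsNext`.
[folklore] -/
def PM (φ : CNF ℕ) (a b c : ℕ) : Prop :=
  (b < M φ ∧ ((a = b ∧ c = tip b true) ∨ (a < M φ ∧ IsNext φ a b ∧ c = tip b false))) ∨
    (M φ ≤ b ∧ a = b ∧ SelP φ b c)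

/-- The machine form agrees with the triple predicate. [folklore] -/
theorem PM_iff_P {a b c : ℕ} : PM φ a b c ↔ P φ a b c := by
  unfold PM P
  constructor
  · rintro (⟨hb, ⟨rfl, rfl⟩ | ⟨ha, hn, rfl⟩⟩ | h)
    · exact Or.inl ⟨hb, Or.inl ⟨rfl, rfl⟩⟩
    · exact Or.inl ⟨hb, Or.inr ⟨(isNext_iff hb ha).1 hn, rfl⟩⟩
    · exact Or.inr h
  · rintro (⟨hb, ⟨rfl, rfl⟩ | ⟨rfl, rfl⟩⟩ | h)
    · exact Or.inl ⟨hb, Or.inl ⟨rfl, rfl⟩⟩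
    · exact Or.inl ⟨hb, Or.inr ⟨next_lt hb, (isNext_iff hb (next_lt hb)).2 rfl, rfl⟩⟩
    · exact Or.inr h

/-- **The code of the instance**: the numeral of `q` paired with the characteristic vector of `U` in
the row-major order of `finTripleEquiv` (bit `k` tests the triple `(k / q², (k mod q²) / q, k mod q)`).
[cite: Karp1972, §3  problem 17 (3-DIMENSIONAL MATCHING)] -/
theorem encode_inst (φ : CNF ℕ) :
    encodingTriples.encode (inst φ) = boolPair (encodeNat (q φ))
      (List.ofFn fun k : Fin (q φ * (q φ * q φ)) =>
        decide (P φ (k / (q φ * q φ)) (k % (q φ * q φ) / q φ) (k % (q φ * q φ) % q φ))) := by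
  rw [encodingTriples_encode]
  show boolPair (encodeNat (q φ)) (List.ofFn fun i : Fin (q φ * (q φ * q φ)) =>
    decide (i ∈ (finTripleEquiv (q φ)).finsetCongr (U φ))) = _
  congr 1
  refine List.ofFn_inj.2 (funext fun k => decide_eq_decide.2 ?_)
  rw [Equiv.finsetCongr_apply, Finset.mem_map_equiv, mem_U_iff]
  simp [finTripleEquiv, Fin.coe_divNat, Fin.coe_modNat]

end ThreeDM

end Literature.Computability.Complexity
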